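import Summits.CriticalPhenomena.PercolationContinuityZ3.Theorems.SahiTP2Positivity
import Mathlib.Analysis.SpecialFunctions.Trigonometric.Arctan

/-!
# Every TP₂-across-cuts law on the plane is Sahi-positive of every order (no strip hypothesis)

Companion of `SahiTP2Kernel.lean` / `SahiTP2Positivity.lean` (cell `prim-sahi`, typer seat, generation 10;
`--supports stmt-CriticalPhenomena-4575`).

`SahiTP2Positivity.msahiE_nonneg_of_isTP2Cut` needs the second coordinate to live in a bounded strip, because the
everywhere-monotone kernel version of `SahiTP2Kernel` does (a conditionally increasing law on `ℝ²` need not admit an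
EVERYWHERE stochastically monotone version of its conditional law: for `Y = 1/(1-X)`, `X` uniform on `(0,1)`, any
version must put `κ_1` above every `δ_{1/(1-x)}`).  Sahi positivity does not care: compactify the second coordinate by
`arctan` (a monotone bijection onto `(-π/2, π/2)`, so `IsTP2Cut` is preserved, `IsTP2Cut.map_arctan`), and extend the
pulled-back BOUNDED monotone family monotonically across the two horizontal lines `v = ±π/2` by its fibrewise infimum /
supremum (`extendTan`).  Result:

* `msahiE_nonneg_of_isTP2Cut_real` — **every probability measure on `ℝ²` that is TP₂ across cuts is Sahi-positive
  of every order** for bounded measurable nonnegative monotone (increasing) families; `…_antitone` for decreasing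
  families (point reflection `(x,y) ↦ (-x,-y)` preserves `IsTP2Cut`, `IsTP2Cut.map_neg`).

This contains the generation-9 theorems on CIS laws / Gaussian regression / bivariate Gaussians with `ρ ≥ 0`, with an
intrinsic hypothesis and for singular laws.  No sorries, no new axioms.
-/

noncomputable section

namespace Summit.CriticalPhenomena.PercolationContinuityZ3.Theorems.SahiTP2

open MeasureTheory ProbabilityTheory Set Filter Topology Function Real
open Literature.Combinatorics.Sahi2008
open scoped ENNReal

/-! ## Compactifying the second coordinate -/

/-- `tan` is measurable (as `sin / cos`). [folklore] -/
theorem measurable_tan : Measurable Real.tan := by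
  have h : Real.tan = fun x => Real.sin x / Real.cos x := funext Real.tan_eq_sin_div_cos
  rw [h]
  exact Real.continuous_sin.measurable.div Real.continuous_cos.measurable

/-- **`IsTP2Cut` is preserved by `(x,y) ↦ (x, arctan y)`** (a monotone bijection in the second coordinate pulls
lower sets back to lower sets). [this work] -/
theorem IsTP2Cut.map_arctan (ρ : Measure (ℝ × ℝ)) (hρ : IsTP2Cut ρ) :
    IsTP2Cut (ρ.map (fun p : ℝ × ℝ => (p.1, Real.arctan p.2))) := by
  have hm : Measurable (fun p : ℝ × ℝ => (p.1, Real.arctan p.2)) :=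
    measurable_fst.prodMk (continuous_arctan.measurable.comp measurable_snd)
  intro a₁ b₁ a₂ b₂ hlt L hL hLm
  have hpre : ∀ (s T : Set ℝ), MeasurableSet s → MeasurableSet T →
      ρ.map (fun p : ℝ × ℝ => (p.1, Real.arctan p.2)) (s ×ˢ T) = ρ (s ×ˢ (Real.arctan ⁻¹' T)) := by
    intro s T hs hT
    rw [Measure.map_apply hm (hs.prod hT)]
    rfl
  rw [hpre _ _ measurableSet_Icc hLm.compl, hpre _ _ measurableSet_Icc hLm, hpre _ _ measurableSet_Icc hLm,
    hpre _ _ measurableSet_Icc hLm.compl, preimage_compl]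
  exact hρ hlt (fun x y hyx hx => hL (arctan_mono hyx) hx) (continuous_arctan.measurable hLm)

/-- **`IsTP2Cut` is preserved by the point reflection** `(x,y) ↦ (-x,-y)`. [this work] -/
theorem IsTP2Cut.map_neg (ρ : Measure (ℝ × ℝ)) (hρ : IsTP2Cut ρ) :
    IsTP2Cut (ρ.map (fun p : ℝ × ℝ => (-p.1, -p.2))) := by
  have hm : Measurable (fun p : ℝ × ℝ => (-p.1, -p.2)) := measurable_fst.neg.prodMk measurable_snd.neg
  intro a₁ b₁ a₂ b₂ hlt L hL hLm
  have hpre : ∀ (s T : Set ℝ), MeasurableSet s → MeasurableSet T →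
      ρ.map (fun p : ℝ × ℝ => (-p.1, -p.2)) (s ×ˢ T) = ρ ((Neg.neg ⁻¹' s) ×ˢ (Neg.neg ⁻¹' T)) := by
    intro s T hs hT
    rw [Measure.map_apply hm (hs.prod hT)]
    rfl
  have hIcc : ∀ a b : ℝ, Neg.neg ⁻¹' Icc a b = Icc (-b) (-a) := fun a b => by
    ext x; simp only [mem_preimage, mem_Icc]; constructor <;> intro h <;> constructor <;> linarith [h.1, h.2]
  rw [hpre _ _ measurableSet_Icc hLm.compl, hpre _ _ measurableSet_Icc hLm, hpre _ _ measurableSet_Icc hLm,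
    hpre _ _ measurableSet_Icc hLm.compl, hIcc, hIcc, preimage_compl]
  set U : Set ℝ := Neg.neg ⁻¹' L with hU
  have hUc : IsLowerSet Uᶜ := fun x y hyx hx hy => hx (hL (neg_le_neg hyx) hy)
  have hUm : MeasurableSet U := measurable_neg hLm
  have hlt' : -a₂ < -b₁ := neg_lt_neg hlt
  have key := hρ hlt' hUc hUm.compl (a₁ := -b₂) (b₂ := -a₁)
  rw [compl_compl] at key
  calc ρ (Icc (-b₁) (-a₁) ×ˢ Uᶜ) * ρ (Icc (-b₂) (-a₂) ×ˢ U)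
      = ρ (Icc (-b₂) (-a₂) ×ˢ U) * ρ (Icc (-b₁) (-a₁) ×ˢ Uᶜ) := mul_comm _ _
    _ ≤ ρ (Icc (-b₂) (-a₂) ×ˢ Uᶜ) * ρ (Icc (-b₁) (-a₁) ×ˢ U) := key
    _ = ρ (Icc (-b₁) (-a₁) ×ˢ U) * ρ (Icc (-b₂) (-a₂) ×ˢ Uᶜ) := mul_comm _ _

/-! ## Monotone extension across the lines `v = ±π/2` -/

section Extend

variable (f : ℝ × ℝ → ℝ)

/-- The fibrewise infimum `inf_k f(x,-k)` of a bounded family (a lower envelope in the second variable). [this work] -/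
def loEnv (x : ℝ) : ℝ := ⨅ k : ℕ, f (x, -(k : ℝ))

/-- The fibrewise supremum `sup_k f(x,k)`. [this work] -/
def hiEnv (x : ℝ) : ℝ := ⨆ k : ℕ, f (x, (k : ℝ))

/-- **Monotone extension** of `(x,v) ↦ f(x, tan v)` from the open strip `|v| < π/2` to the plane: below the strip the
fibrewise infimum, above it the fibrewise supremum. [this work] -/
def extendTan (p : ℝ × ℝ) : ℝ :=
  if p.2 ≤ -(π / 2) then loEnv f p.1 else if π / 2 ≤ p.2 then hiEnv f p.1 else f (p.1, Real.tan p.2)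

variable {f} {M : ℝ}

/-- Boundedness below of the fibre values (plumbing). [folklore] -/
theorem bddBelow_fibre (hf0 : ∀ p, 0 ≤ f p) (x : ℝ) : BddBelow (range fun k : ℕ => f (x, -(k : ℝ))) :=
  ⟨0, by rintro _ ⟨j, rfl⟩; exact hf0 _⟩

/-- Boundedness above of the fibre values (plumbing). [folklore] -/
theorem bddAbove_fibre (hfM : ∀ p, f p ≤ M) (x : ℝ) : BddAbove (range fun k : ℕ => f (x, (k : ℝ))) :=
  ⟨M, by rintro _ ⟨j, rfl⟩; exact hfM _⟩

/-- The lower envelope is below every fibre value. [this work] -/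
theorem loEnv_le (hf0 : ∀ p, 0 ≤ f p) (hmono : Monotone f) (x y : ℝ) : loEnv f x ≤ f (x, y) := by
  obtain ⟨k, hk⟩ := exists_nat_ge (-y)
  have h1 : loEnv f x ≤ f (x, -(k : ℝ)) := ciInf_le (bddBelow_fibre hf0 x) k
  exact h1.trans (hmono (show ((x, -(k : ℝ)) : ℝ × ℝ) ≤ (x, y) from ⟨le_rfl, by linarith⟩))

/-- Every fibre value is below the upper envelope. [this work] -/
theorem le_hiEnv (hfM : ∀ p, f p ≤ M) (hmono : Monotone f) (x y : ℝ) : f (x, y) ≤ hiEnv f x := by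
  obtain ⟨k, hk⟩ := exists_nat_ge y
  have h1 : f (x, (k : ℝ)) ≤ hiEnv f x := le_ciSup (bddAbove_fibre hfM x) k
  exact (hmono (show ((x, y) : ℝ × ℝ) ≤ (x, (k : ℝ)) from ⟨le_rfl, hk⟩)).trans h1

/-- The lower envelope is nonnegative. [this work] -/
theorem loEnv_nonneg (hf0 : ∀ p, 0 ≤ f p) (x : ℝ) : 0 ≤ loEnv f x := le_ciInf fun _ => hf0 _

/-- The upper envelope is bounded by `M`. [this work] -/
theorem hiEnv_le (hfM : ∀ p, f p ≤ M) (x : ℝ) : hiEnv f x ≤ M := ciSup_le fun _ => hfM _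

/-- The lower envelope is monotone. [this work] -/
theorem loEnv_mono (hf0 : ∀ p, 0 ≤ f p) (hmono : Monotone f) : Monotone (loEnv f) := fun x x' hxx' =>
  le_ciInf fun k => (ciInf_le (bddBelow_fibre hf0 x) k).trans
    (hmono (show ((x, -(k : ℝ)) : ℝ × ℝ) ≤ (x', -(k : ℝ)) from ⟨hxx', le_rfl⟩))

/-- The upper envelope is monotone. [this work] -/
theorem hiEnv_mono (hfM : ∀ p, f p ≤ M) (hmono : Monotone f) : Monotone (hiEnv f) := fun x x' hxx' =>
  ciSup_le fun k => (hmono (show ((x, (k : ℝ)) : ℝ × ℝ) ≤ (x', (k : ℝ)) from ⟨hxx', le_rfl⟩)).trans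
    (le_ciSup (bddAbove_fibre hfM x') k)

/-- The extension is nonnegative. [this work] -/
theorem extendTan_nonneg (hf0 : ∀ p, 0 ≤ f p) (hfM : ∀ p, f p ≤ M) (hmono : Monotone f) (p : ℝ × ℝ) :
    0 ≤ extendTan f p := by
  unfold extendTan
  split_ifs
  · exact loEnv_nonneg hf0 _
  · exact (hf0 _).trans (le_hiEnv hfM hmono _ 0)
  · exact hf0 _

/-- The extension is bounded by `M`. [this work] -/
theorem extendTan_le (hf0 : ∀ p, 0 ≤ f p) (hfM : ∀ p, f p ≤ M) (hmono : Monotone f) (p : ℝ × ℝ) :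
    extendTan f p ≤ M := by
  unfold extendTan
  split_ifs
  · exact (loEnv_le hf0 hmono _ 0).trans (hfM _)
  · exact hiEnv_le hfM _
  · exact hfM _

/-- **The extension is monotone on the whole plane.** [this work] -/
theorem extendTan_mono (hf0 : ∀ p, 0 ≤ f p) (hfM : ∀ p, f p ≤ M) (hmono : Monotone f) :
    Monotone (extendTan f) := by
  intro p q hpq
  have h1 : p.1 ≤ q.1 := hpq.1
  have h2 : p.2 ≤ q.2 := hpq.2
  have hx : ∀ y : ℝ, f (p.1, y) ≤ f (q.1, y) := fun y =>
    hmono (show ((p.1, y) : ℝ × ℝ) ≤ (q.1, y) from ⟨h1, le_rfl⟩)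
  unfold extendTan
  by_cases hp : p.2 ≤ -(π / 2)
  · rw [if_pos hp]
    split_ifs
    · exact loEnv_mono hf0 hmono h1
    · exact (loEnv_le hf0 hmono p.1 0).trans ((hx 0).trans (le_hiEnv hfM hmono q.1 0))
    · exact (loEnv_le hf0 hmono p.1 _).trans (hx _)
  rw [if_neg hp]
  have hq : ¬ q.2 ≤ -(π / 2) := fun h => hp (h2.trans h)
  rw [if_neg hq]
  by_cases hp' : π / 2 ≤ p.2
  · rw [if_pos hp', if_pos (hp'.trans h2)]
    exact hiEnv_mono hfM hmono h1
  rw [if_neg hp']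
  split_ifs with hq'
  · exact (hx _).trans (le_hiEnv hfM hmono q.1 _)
  · refine (hx _).trans (hmono (show ((q.1, Real.tan p.2) : ℝ × ℝ) ≤ (q.1, Real.tan q.2) from ⟨le_rfl, ?_⟩))
    rcases h2.eq_or_lt with h | h
    · rw [h]
    · exact (tan_lt_tan_of_lt_of_lt_pi_div_two (not_le.1 hp) (not_le.1 hq') h).le

/-- The extension is measurable. [this work] -/
theorem measurable_extendTan (hfm : Measurable f) : Measurable (extendTan f) := by
  have hlo : Measurable (loEnv f) := Measurable.iInf fun k => hfm.comp (measurable_id.prodMk measurable_const)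
  have hhi : Measurable (hiEnv f) := Measurable.iSup fun k => hfm.comp (measurable_id.prodMk measurable_const)
  refine Measurable.ite (measurableSet_le measurable_snd measurable_const) (hlo.comp measurable_fst) ?_
  refine Measurable.ite (measurableSet_le measurable_const measurable_snd) (hhi.comp measurable_fst) ?_
  exact hfm.comp (measurable_fst.prodMk (measurable_tan.comp measurable_snd))

/-- On the image of `(x,y) ↦ (x, arctan y)` the extension IS `f`. [this work] -/
theorem extendTan_arctan (p : ℝ × ℝ) : extendTan f (p.1, Real.arctan p.2) = f p := by
  unfold extendTan
  rw [if_neg (not_le.2 (neg_pi_div_two_lt_arctan p.2)), if_neg (not_le.2 (arctan_lt_pi_div_two p.2)), tan_arctan]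

end Extend

/-! ## The plane -/

/-- **Every probability measure on `ℝ²` that is TP₂ across cuts is Sahi-positive of every order**, for bounded
measurable nonnegative monotone (increasing) families — no strip, density or continuity hypothesis. [this work] -/
theorem msahiE_nonneg_of_isTP2Cut_real (ρ : Measure (ℝ × ℝ)) [IsProbabilityMeasure ρ] (hρ : IsTP2Cut ρ) (n : ℕ)
    (f : Fin n → ℝ × ℝ → ℝ) (hfm : ∀ i, Measurable (f i)) (hf0 : ∀ i p, 0 ≤ f i p) {M : ℝ}
    (hfM : ∀ i p, f i p ≤ M) (hmono : ∀ i, Monotone (f i)) : 0 ≤ msahiE ρ n f := by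
  set Φ : ℝ × ℝ → ℝ × ℝ := fun p => (p.1, Real.arctan p.2) with hΦ
  have hΦm : Measurable Φ := measurable_fst.prodMk (continuous_arctan.measurable.comp measurable_snd)
  haveI : IsProbabilityMeasure (ρ.map Φ) := Measure.isProbabilityMeasure_map hΦm.aemeasurable
  have hY : ∀ᵐ p ∂(ρ.map Φ), p.2 ∈ Icc (-(π / 2)) (π / 2) := by
    rw [ae_map_iff hΦm.aemeasurable (measurableSet_Icc.preimage measurable_snd)]
    exact ae_of_all _ fun p => ⟨(neg_pi_div_two_lt_arctan p.2).le, (arctan_lt_pi_div_two p.2).le⟩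
  have hmp : MeasurePreserving Φ ρ (ρ.map Φ) := ⟨hΦm, rfl⟩
  have hcomp : (fun i => extendTan (f i) ∘ Φ) = f := by
    funext i p
    exact extendTan_arctan p
  have h := msahiE_nonneg_of_isTP2Cut (ρ.map Φ) (IsTP2Cut.map_arctan ρ hρ) hY n (fun i => extendTan (f i))
    (fun i => measurable_extendTan (hfm i)) (fun i p => extendTan_nonneg (hf0 i) (hfM i) (hmono i) p)
    (fun i p => extendTan_le (hf0 i) (hfM i) (hmono i) p) fun i => extendTan_mono (hf0 i) (hfM i) (hmono i)
  rwa [← msahiE_comp_measurePreserving_of_measurable hmp n _ fun i => measurable_extendTan (hfm i), hcomp] at h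

/-- **Decreasing form on the plane**: every TP₂-across-cuts probability law on `ℝ²` has `E_n ≥ 0` for bounded
measurable nonnegative monotone decreasing families. [this work] -/
theorem msahiE_nonneg_of_isTP2Cut_real_antitone (ρ : Measure (ℝ × ℝ)) [IsProbabilityMeasure ρ] (hρ : IsTP2Cut ρ)
    (n : ℕ) (f : Fin n → ℝ × ℝ → ℝ) (hfm : ∀ i, Measurable (f i)) (hf0 : ∀ i p, 0 ≤ f i p) {M : ℝ}
    (hfM : ∀ i p, f i p ≤ M) (hanti : ∀ i, Antitone (f i)) : 0 ≤ msahiE ρ n f := by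
  set sy : ℝ × ℝ → ℝ × ℝ := fun p => (-p.1, -p.2) with hsy
  have hsm : Measurable sy := measurable_fst.neg.prodMk measurable_snd.neg
  have hss : sy ∘ sy = id := by
    funext p
    simp [hsy]
  haveI : IsProbabilityMeasure (ρ.map sy) := Measure.isProbabilityMeasure_map hsm.aemeasurable
  have hmp : MeasurePreserving sy (ρ.map sy) ρ := by
    refine ⟨hsm, ?_⟩
    rw [Measure.map_map hsm hsm, hss, Measure.map_id]
  rw [← msahiE_comp_measurePreserving_of_measurable hmp n f hfm]
  refine msahiE_nonneg_of_isTP2Cut_real (ρ.map sy) (IsTP2Cut.map_neg ρ hρ) n (fun i => f i ∘ sy)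
    (fun i => (hfm i).comp hsm) (fun i p => hf0 i _) (fun i p => hfM i _) fun i p q hpq => hanti i ?_
  exact ⟨neg_le_neg hpq.1, neg_le_neg hpq.2⟩

end Summit.CriticalPhenomena.PercolationContinuityZ3.Theorems.SahiTP2
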